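import Literature.Topology.FourManifolds.MorseAffine
import Literature.Topology.FourManifolds.BallRemovalCobordism
import Literature.Topology.FourManifolds.SPC4MorseExistence
import Literature.Topology.FourManifolds.SPC4HandleChainProofs
import Literature.Topology.FourManifolds.MorseRearrangementProofs
import Literature.Topology.FourManifolds.MilnorBoxSurface
import Literature.Topology.FourManifolds.GradientLikeExistence
import Literature.Topology.FourManifolds.SphereSimplyConnected
import Literature.AlgebraicTopology.FundamentalGroupoid.SimplyConnectedComplPoint
import Literature.Topology.FourManifolds.HCobordismLevelSimplyConnected
import Literature.Topology.FourManifolds.ClosedAsCobordism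
import HarnessLib

/-!
# Wall 1964, Lemma 2, Morse-theoretic route: the bounding manifold as a triad `(W; ∅, M)`,
# a Morse function with a unique bottom critical point, and the ball below its first level

Topic `Literature/Topology/FourManifolds` (fact seat
`provefact-Literature.Topology.FourManifolds.exists-68ee520c9a`, Wall 1964, Lemma 2,
`WallBoundingHandlebody.lean`, item 1 of the route recorded there: *"Ball removal. For an
interior chart ball `B ⊂ W`, `K = W ∖ B̊` is a cobordism from `𝕊⁴` to `M`, simply connected"*).
Everything here is **proved**; no named facts.

Instead of removing an abstract ball and gluing, the ball is chosen *below the first level of a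
Morse function*, so that all later pieces are slabs of one Morse function on `W` (Milnor,
*Lectures on the h-cobordism theorem* (1965), §2 and Def. 3.1; *Morse theory* (1963), §3):

* `NullCobordism.cob c`: the bounding manifold `W` of `M = ∂W` as the triad `(W; ∅, M)`, i.e.
  a `Cobordism n PEmpty M` (Milnor 1965, Def. 1.3 with `V₀ = ∅`), and
  `NullCobordism.exists_isMorseFunction_injOn`: a Morse function on it (Def. 3.1: `= 1` exactly
  on `M`, regular there, values in `(0, 1)` inside) with distinct critical values (Lemma 2.8) —
  from the tree's existence of Morse functions adapted to the boundary (Thm. 2.5,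
  `exists_isMorseAdapted_realHalfSpace`) rescaled affinely, and Lemma 2.8
  (`Cobordism.Milnor1965_exists_injOn_criticalSet_holds`).
* `NullCobordism.BottomBall c`: the data of such a function `f` together with its bottom
  critical point `p₀` — the unique global minimum, an interior critical point of index `0` — a
  Morse chart `φ` at `p₀` in which `f = f(p₀) + ‖φ̂ - φ̂(p₀)‖²` (Milnor 1965, Def. 3.1 / Morse
  lemma with index `0`; the tree's `IsGradientLike.exists_milnorBox_source_subset`), and a radius
  `ε` so small that the sublevel set `{f ≤ f(p₀) + ε²}` is *exactly* the chart ball of radius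
  `ε` and the level `a₀ = f(p₀) + ε²` lies below every other critical value (and below `1`);
  `NullCobordism.nonempty_bottomBall`: existence (compactness of `W` away from the chart ball).
* Consequences: the level `f⁻¹(a₀)` is a round sphere in the chart
  (`BottomBall.levelHomeomorphSphere`), hence simply connected in dimension `n + 1 ≥ 3`
  (`BottomBall.simplyConnectedSpace_of_range_eq_level`, by `simplyConnectedSpace_sphere`); the
  sublevel set `{f ≤ a₀}` is homeomorphic to a closed Euclidean ball
  (`BottomBall.sublevelHomeomorphClosedBall`), hence contractible; and the superlevel set
  `{a₀ ≤ f} = W ∖ B̊` is simply connected when `W` is (`BottomBall.isSimplyConnected_setOf_le`: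
  it is a retract of `W ∖ {p₀}` by radial projection in the chart, and `W ∖ {p₀}` is simply
  connected by general position in dimension `≥ 3`,
  `isSimplyConnected_compl_singleton_of_isOpenEmbedding`; Hatcher Prop. 1.17, Kosinski VI.2).

## References

* J. Milnor, *Lectures on the h-cobordism theorem* (1965), Def. 1.3, §2 (Thm. 2.5, Lemma 2.8),
  Def. 3.1 (PDF pp. 2–12). [MilnorHCobordism1965]
* J. Milnor, *Morse theory*, Ann. of Math. Studies 51 (1963), Lemma 2.2, §3. [Milnor1963]
* C. T. C. Wall, *On simply-connected 4-manifolds*, J. London Math. Soc. 39 (1964), proof of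
  Lemma 2 (p. 144: "we first imbed a disc `D⁵` in the interior of `W`"). [WallJLMS1964]
* A. Hatcher, *Algebraic Topology* (2002), Prop. 1.14, Prop. 1.17. [HatcherAT2002]
-/

open scoped Manifold ContDiff Topology
open Set Function Metric Filter

noncomputable section

universe u

namespace Literature.Topology.FourManifolds

/-- Local notation: `𝔼 n` is the model Euclidean space `EuclideanSpace ℝ (Fin n)`. -/
local notation "𝔼 " n:arg => EuclideanSpace ℝ (Fin n)
/-- Local notation: `ℍ n` is the model half-space `EuclideanHalfSpace n`. -/
local notation "ℍ " n:arg => EuclideanHalfSpace n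

section Setting

variable {n : ℕ} {M : Type u} [TopologicalSpace M] [ChartedSpace (𝔼 n) M]

namespace NullCobordism

/-- **The bounding manifold as a triad `(W; ∅, M)`**: a null-cobordism `M = ∂W` read as a
cobordism from the empty manifold to `M` (Milnor 1965, Def. 1.3 with `V₀ = ∅`; the tree's
`NullCobordism.toCobordism`, reversed so that Morse functions increase towards `M`).
[cite: MilnorHCobordism1965, Def. 1.3 (PDF p. 2)] -/
def cob (c : NullCobordism n M) : Cobordism n PEmpty.{u + 1} M := (c.toCobordism PEmpty).symm

/-- The total space of `(W; ∅, M)` is `W` (definitional). [folklore] -/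
@[simp] theorem cob_W (c : NullCobordism n M) : c.cob.W = c.W := rfl

/-- The outgoing end of `(W; ∅, M)` is the boundary inclusion `M = ∂W` (definitional).
[folklore] -/
@[simp] theorem cob_inr (c : NullCobordism n M) : c.cob.inr = c.incl := rfl

/-- The boundary of `W` is the image of `M`. [folklore] -/
theorem range_cob_inr (c : NullCobordism n M) : range c.cob.inr = (𝓡∂ (n + 1)).boundary c.W :=
  c.range_incl

variable (c : NullCobordism n M)

/-- **A Morse function on `(W; ∅, M)` from a Morse function adapted to `∂W`.**  If `f` is Morse
on `W`, `= 1` and regular on `∂W = M` and `< 1` inside (`IsMorseAdapted`), then for a lower bound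
`m ≤ f` the affine rescaling `(f - m + 1)/(2 - m)` is a Morse function on the triad `(W; ∅, M)`
in the sense of Milnor's Def. 3.1 (`= 1` exactly on `M`, values in `(0, 1)` inside).
[cite: MilnorHCobordism1965, Def. 3.1 (PDF p. 11), with Thm. 4.8 (renormalisation)] -/
theorem isMorseFunction_cob_of_isMorseAdapted {f : c.W → ℝ} (hf : IsMorseAdapted (𝓡∂ (n + 1)) f)
    {m : ℝ} (hm : ∀ z, m ≤ f z) (hm1 : m ≤ 1) :
    c.cob.IsMorseFunction fun z => (2 - m)⁻¹ * f z + (2 - m)⁻¹ * (1 - m) := by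
  have h2m : 0 < 2 - m := by linarith
  have hne : (2 - m)⁻¹ ≠ 0 := inv_ne_zero h2m.ne'
  have hd : MDifferentiable (𝓡∂ (n + 1)) 𝓘(ℝ, ℝ) f := hf.1.contMDiff.mdifferentiable (by simp)
  refine ⟨hf.1.const_mul_add hne _, fun x => isEmptyElim x, fun y => ?_, fun (z : c.W) hz => ?_,
    fun (z : c.W) hz => ?_⟩
  · have hy : c.incl y ∈ (𝓡∂ (n + 1)).boundary c.W := c.incl_mem_boundary y
    have h1 : f (c.incl y) = 1 := (hf.2.1 _ hy).1
    show (2 - m)⁻¹ * f (c.incl y) + (2 - m)⁻¹ * (1 - m) = 1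
    rw [h1]
    field_simp
    ring
  · show ¬ IsMCriticalPt (𝓡∂ (n + 1)) (fun z : c.W => (2 - m)⁻¹ * f z + (2 - m)⁻¹ * (1 - m)) z
    rw [isMCriticalPt_const_mul_add_iff hne _ (hd z)]
    exact (hf.2.1 z hz).2
  · have h1 : f z < 1 := hf.2.2 z hz
    have h0 : m ≤ f z := hm z
    have heq : (2 - m)⁻¹ * f z + (2 - m)⁻¹ * (1 - m) = (f z - m + 1) / (2 - m) := by
      field_simp; ring
    show (2 - m)⁻¹ * f z + (2 - m)⁻¹ * (1 - m) ∈ Ioo (0 : ℝ) 1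
    rw [heq]
    constructor
    · have : 0 < f z - m + 1 := by linarith
      positivity
    · rw [div_lt_one h2m]
      linarith

/-! ### The bottom critical point and the ball below the first level -/

/-- **Wall's bottom ball, Morse-theoretically.**  The data: a Morse function `f` on the triad
`(W; ∅, M)` with distinct critical values; its bottom critical point `p₀` — the unique global
minimum, an interior critical point; a chart `φ` of the maximal atlas at `p₀`, a closed chart
ball of radius `ρ` and the normal form `f = f(p₀) + ‖φ̂ - φ̂(p₀)‖²` on the chart domain (the
Morse lemma at a minimum, Milnor 1965, Def. 3.1 with `λ = 0`); and a radius `0 < ε < ρ` such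
that the level `a₀ = f(p₀) + ε²` is `< 1` and below every other critical value, and the
sublevel set `{f ≤ a₀}` lies in the chart domain (so that it is the chart ball of radius `ε`,
`BottomBall.setOf_le_eq`).  This is the disc "`D⁵` in the interior of `W`" of Wall's proof of
Lemma 2 (1964, p. 144), placed below the first critical level.
[cite: WallJLMS1964, proof of Lemma 2 (p. 144)] [cite: MilnorHCobordism1965, Def. 3.1 (PDF pp. 11–12)] -/
structure BottomBall (c : NullCobordism n M) where
  /-- The Morse function on `(W; ∅, M)`. -/
  f : c.W → ℝ
  /-- It is a Morse function on the triad (Milnor's Def. 3.1). -/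
  isMorseFunction : c.cob.IsMorseFunction f
  /-- Its critical values are distinct (Lemma 2.8). -/
  injOn : InjOn f (criticalSet (𝓡∂ (n + 1)) f)
  /-- The bottom critical point. -/
  p₀ : c.W
  /-- `p₀` is a global minimum of `f`. -/
  apply_le : ∀ q, f p₀ ≤ f q
  /-- `p₀` is an interior point. -/
  isInteriorPoint : (𝓡∂ (n + 1)).IsInteriorPoint p₀
  /-- `p₀` is a critical point. -/
  isMCriticalPt : IsMCriticalPt (𝓡∂ (n + 1)) f p₀
  /-- The Morse chart at `p₀`. -/
  chart : OpenPartialHomeomorph c.W (ℍ (n + 1))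
  /-- The chart belongs to the maximal smooth atlas. -/
  mem_maximalAtlas : chart ∈ IsManifold.maximalAtlas (𝓡∂ (n + 1)) ∞ c.W
  /-- `p₀` lies in the chart domain. -/
  mem_source : p₀ ∈ chart.source
  /-- The radius of the chart ball. -/
  ρ : ℝ
  /-- The chart ball has positive radius. -/
  ρ_pos : 0 < ρ
  /-- The closed chart ball of radius `ρ` about `φ̂ p₀` lies in the chart target. -/
  closedBall_subset :
    Metric.closedBall (chart.extend (𝓡∂ (n + 1)) p₀) ρ ⊆ (chart.extend (𝓡∂ (n + 1))).target
  /-- The normal form of `f` at the minimum `p₀`: `f = f(p₀) + ‖φ̂ - φ̂(p₀)‖²`. -/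
  apply_eq : ∀ q ∈ chart.source,
    f q = f p₀ + ‖chart.extend (𝓡∂ (n + 1)) q - chart.extend (𝓡∂ (n + 1)) p₀‖ ^ 2
  /-- The radius of the bottom ball. -/
  ε : ℝ
  /-- The bottom ball has positive radius. -/
  ε_pos : 0 < ε
  /-- The bottom ball lies inside the chart ball. -/
  ε_lt : ε < ρ
  /-- The bottom level `a₀ = f(p₀) + ε²` is below `1`. -/
  level_lt_one : f p₀ + ε ^ 2 < 1
  /-- The bottom level is below every other critical value. -/
  level_lt_apply : ∀ q ∈ criticalSet (𝓡∂ (n + 1)) f, q ≠ p₀ → f p₀ + ε ^ 2 < f q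
  /-- The sublevel set `{f ≤ a₀}` lies in the chart domain. -/
  setOf_le_subset : {q | f q ≤ f p₀ + ε ^ 2} ⊆ chart.source

/-- Milnor's quadratic form of index `0` is `‖u‖²` (`sqSumLT_zero`, `sqSumGE_zero` of
`MilnorBoxSurface.lean`). [cite: MilnorHCobordism1965, Def. 3.1 (λ = 0)] -/
theorem milnorQuadratic_zero_left {m : ℕ} (u : 𝔼 m) : milnorQuadratic 0 u = ‖u‖ ^ 2 := by
  rw [milnorQuadratic_eq, sqSumLT_zero, sqSumGE_zero, neg_zero, zero_add]

namespace BottomBall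

variable {c} (B : c.BottomBall)

/-- The bottom level `a₀ = f(p₀) + ε²`. [cite: WallJLMS1964, proof of Lemma 2 (p. 144)] -/
def botLevel : ℝ := B.f B.p₀ + B.ε ^ 2

/-- Unfolding `botLevel`. [folklore] -/
theorem botLevel_def : B.botLevel = B.f B.p₀ + B.ε ^ 2 := rfl

/-- The centred chart coordinates `φ̂ - φ̂(p₀)`. [folklore] -/
def coord (q : c.W) : 𝔼 (n + 1) :=
  B.chart.extend (𝓡∂ (n + 1)) q - B.chart.extend (𝓡∂ (n + 1)) B.p₀

/-- Unfolding `coord`. [folklore] -/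
theorem coord_def (q : c.W) :
    B.coord q = B.chart.extend (𝓡∂ (n + 1)) q - B.chart.extend (𝓡∂ (n + 1)) B.p₀ := rfl

/-- The coordinates of the centre vanish. [folklore] -/
@[simp] theorem coord_p₀ : B.coord B.p₀ = 0 := sub_self _

/-- The normal form, in terms of `coord`: `f = f(p₀) + ‖coord‖²` on the chart domain.
[cite: MilnorHCobordism1965, Def. 3.1 (λ = 0)] -/
theorem apply_eq_coord {q : c.W} (hq : q ∈ B.chart.source) : B.f q = B.f B.p₀ + ‖B.coord q‖ ^ 2 :=
  B.apply_eq q hq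

/-- `f` is smooth. [folklore] -/
theorem contMDiff : ContMDiff (𝓡∂ (n + 1)) 𝓘(ℝ, ℝ) ∞ B.f := B.isMorseFunction.isMorse.contMDiff

/-- `f` is continuous. [folklore] -/
theorem continuous : Continuous B.f := B.contMDiff.continuous

/-- The value at the bottom critical point is positive (an interior value of a Morse function
on the triad). [cite: MilnorHCobordism1965, Def. 3.1] -/
theorem apply_p₀_pos : 0 < B.f B.p₀ := (B.isMorseFunction.2.2.2.2 B.p₀ B.isInteriorPoint).1

/-- The bottom level is positive. [folklore] -/
theorem botLevel_pos : 0 < B.botLevel := by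
  rw [botLevel_def]; nlinarith [B.apply_p₀_pos, B.ε_pos]

/-- The bottom level is `< 1`. [folklore] -/
theorem botLevel_lt_one : B.botLevel < 1 := B.level_lt_one

/-- The bottom critical point lies strictly below the bottom level. [folklore] -/
theorem apply_p₀_lt_botLevel : B.f B.p₀ < B.botLevel := by
  rw [botLevel_def]; nlinarith [B.ε_pos]

/-- **The bottom level is not a critical value.** [cite: WallJLMS1964, proof of Lemma 2 (p. 144)] -/
theorem ne_botLevel {q : c.W} (hq : q ∈ criticalSet (𝓡∂ (n + 1)) B.f) : B.f q ≠ B.botLevel := by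
  by_cases hqp : q = B.p₀
  · rw [hqp]; exact B.apply_p₀_lt_botLevel.ne
  · exact (B.level_lt_apply q hq hqp).ne'

/-- The other critical values lie strictly above the bottom level. [folklore] -/
theorem botLevel_lt_apply {q : c.W} (hq : q ∈ criticalSet (𝓡∂ (n + 1)) B.f) (hqp : q ≠ B.p₀) :
    B.botLevel < B.f q :=
  B.level_lt_apply q hq hqp

/-- The coordinates are continuous on the chart domain. [folklore] -/
theorem continuousOn_coord : ContinuousOn B.coord B.chart.source := by
  have h := B.chart.continuousOn_extend (I := 𝓡∂ (n + 1))
  rw [B.chart.extend_source] at h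
  exact h.sub continuousOn_const

/-- Points `φ̂⁻¹(φ̂ p₀ + v)` with `‖v‖ ≤ ρ` lie in the chart domain and have coordinates `v`.
[folklore] -/
theorem symm_add_mem_source {v : 𝔼 (n + 1)} (hv : ‖v‖ ≤ B.ρ) :
    (B.chart.extend (𝓡∂ (n + 1))).symm (B.chart.extend (𝓡∂ (n + 1)) B.p₀ + v) ∈ B.chart.source ∧
      B.coord ((B.chart.extend (𝓡∂ (n + 1))).symm (B.chart.extend (𝓡∂ (n + 1)) B.p₀ + v)) = v := by
  set φ := B.chart.extend (𝓡∂ (n + 1)) with hφ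
  have ht : φ B.p₀ + v ∈ φ.target := B.closedBall_subset (by
    show dist (φ B.p₀ + v) (φ B.p₀) ≤ B.ρ
    rw [dist_eq_norm, add_sub_cancel_left]; exact hv)
  refine ⟨?_, ?_⟩
  · rw [← B.chart.extend_source (I := 𝓡∂ (n + 1))]
    exact φ.map_target ht
  · rw [coord_def, ← hφ, φ.right_inv ht, add_sub_cancel_left]

/-- The chart inverse recovers a point of the chart domain from its coordinates. [folklore] -/
theorem symm_add_coord {q : c.W} (hq : q ∈ B.chart.source) :
    (B.chart.extend (𝓡∂ (n + 1))).symm (B.chart.extend (𝓡∂ (n + 1)) B.p₀ + B.coord q) = q := by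
  rw [coord_def, add_sub_cancel]
  exact B.chart.extend_left_inv (I := 𝓡∂ (n + 1)) hq

/-- **The sublevel set below the bottom level is the chart ball of radius `ε`** (pointwise
form). [cite: WallJLMS1964, proof of Lemma 2 (p. 144)] [cite: Milnor1963, §3 (Thm. 3.1)] -/
theorem apply_le_botLevel_iff (q : c.W) :
    B.f q ≤ B.botLevel ↔ q ∈ B.chart.source ∧ ‖B.coord q‖ ≤ B.ε := by
  constructor
  · intro hq
    have hqs : q ∈ B.chart.source := B.setOf_le_subset hq
    refine ⟨hqs, ?_⟩
    rw [B.apply_eq_coord hqs, botLevel_def] at hq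
    exact (pow_le_pow_iff_left₀ (norm_nonneg _) B.ε_pos.le two_ne_zero).1 (by linarith)
  · rintro ⟨hqs, hqε⟩
    rw [B.apply_eq_coord hqs, botLevel_def]
    nlinarith [norm_nonneg (B.coord q), B.ε_pos]

/-- The sublevel set below the bottom level is the chart ball of radius `ε`.
[cite: WallJLMS1964, proof of Lemma 2 (p. 144)] -/
theorem setOf_le_eq : {q | B.f q ≤ B.botLevel} = {q | q ∈ B.chart.source ∧ ‖B.coord q‖ ≤ B.ε} :=
  Set.ext fun q => B.apply_le_botLevel_iff q

/-- **The bottom level set is the chart sphere of radius `ε`** (pointwise form).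
[cite: WallJLMS1964, proof of Lemma 2 (p. 144)] -/
theorem apply_eq_botLevel_iff (q : c.W) :
    B.f q = B.botLevel ↔ q ∈ B.chart.source ∧ ‖B.coord q‖ = B.ε := by
  constructor
  · intro hq
    have hqs : q ∈ B.chart.source := B.setOf_le_subset (le_of_eq hq)
    refine ⟨hqs, ?_⟩
    rw [B.apply_eq_coord hqs, botLevel_def, add_right_inj] at hq
    exact (sq_eq_sq₀ (norm_nonneg _) B.ε_pos.le).1 hq
  · rintro ⟨hqs, hqε⟩
    rw [B.apply_eq_coord hqs, botLevel_def, hqε]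

/-- The bottom level set is the chart sphere of radius `ε`. [cite: WallJLMS1964, proof of Lemma 2 (p. 144)] -/
theorem preimage_botLevel_eq :
    B.f ⁻¹' {B.botLevel} = {q | q ∈ B.chart.source ∧ ‖B.coord q‖ = B.ε} :=
  Set.ext fun q => B.apply_eq_botLevel_iff q

/-! ### The bottom level is a sphere, the ball below it is contractible -/

/-- **The bottom level is homeomorphic to the unit sphere `Sⁿ`** (scaled chart coordinates).
[cite: WallJLMS1964, proof of Lemma 2 (p. 144)] -/
def levelHomeomorphSphere : ↥(B.f ⁻¹' {B.botLevel}) ≃ₜ Metric.sphere (0 : 𝔼 (n + 1)) 1 where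
  toFun q := ⟨B.ε⁻¹ • B.coord q.1, by
    have hq := (B.apply_eq_botLevel_iff q.1).1 q.2
    rw [mem_sphere_zero_iff_norm, norm_smul, norm_inv, Real.norm_eq_abs, abs_of_pos B.ε_pos, hq.2,
      inv_mul_cancel₀ B.ε_pos.ne']⟩
  invFun y := ⟨(B.chart.extend (𝓡∂ (n + 1))).symm (B.chart.extend (𝓡∂ (n + 1)) B.p₀ + B.ε • (y : 𝔼 (n + 1))), by
    have hy : ‖B.ε • (y : 𝔼 (n + 1))‖ = B.ε := by
      rw [norm_smul, Real.norm_eq_abs, abs_of_pos B.ε_pos, mem_sphere_zero_iff_norm.1 y.2, mul_one]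
    obtain ⟨hs, hc⟩ := B.symm_add_mem_source (v := B.ε • (y : 𝔼 (n + 1))) (by rw [hy]; exact B.ε_lt.le)
    exact (B.apply_eq_botLevel_iff _).2 ⟨hs, by rw [hc, hy]⟩⟩
  left_inv q := by
    have hq := (B.apply_eq_botLevel_iff q.1).1 q.2
    apply Subtype.ext
    show (B.chart.extend (𝓡∂ (n + 1))).symm
      (B.chart.extend (𝓡∂ (n + 1)) B.p₀ + B.ε • (B.ε⁻¹ • B.coord q.1)) = q.1
    rw [smul_smul, mul_inv_cancel₀ B.ε_pos.ne', one_smul]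
    exact B.symm_add_coord hq.1
  right_inv y := by
    apply Subtype.ext
    have hy : ‖B.ε • (y : 𝔼 (n + 1))‖ = B.ε := by
      rw [norm_smul, Real.norm_eq_abs, abs_of_pos B.ε_pos, mem_sphere_zero_iff_norm.1 y.2, mul_one]
    obtain ⟨-, hc⟩ := B.symm_add_mem_source (v := B.ε • (y : 𝔼 (n + 1))) (by rw [hy]; exact B.ε_lt.le)
    show B.ε⁻¹ • B.coord ((B.chart.extend (𝓡∂ (n + 1))).symm
      (B.chart.extend (𝓡∂ (n + 1)) B.p₀ + B.ε • (y : 𝔼 (n + 1)))) = y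
    rw [hc, smul_smul, inv_mul_cancel₀ B.ε_pos.ne', one_smul]
  continuous_toFun := by
    refine Continuous.subtype_mk (Continuous.const_smul ?_ B.ε⁻¹) _
    have hsub : ∀ q : ↥(B.f ⁻¹' {B.botLevel}), q.1 ∈ B.chart.source := fun q =>
      ((B.apply_eq_botLevel_iff q.1).1 q.2).1
    exact B.continuousOn_coord.comp_continuous continuous_subtype_val hsub
  continuous_invFun := by
    refine Continuous.subtype_mk ?_ _
    have h1 : Continuous fun y : Metric.sphere (0 : 𝔼 (n + 1)) 1 =>
        B.chart.extend (𝓡∂ (n + 1)) B.p₀ + B.ε • (y : 𝔼 (n + 1)) :=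
      continuous_const.add (continuous_subtype_val.const_smul B.ε)
    refine (B.chart.continuousOn_extend_symm (I := 𝓡∂ (n + 1))).comp_continuous h1 fun y => ?_
    refine B.closedBall_subset ?_
    show dist _ _ ≤ B.ρ
    rw [dist_eq_norm, add_sub_cancel_left, norm_smul, Real.norm_eq_abs, abs_of_pos B.ε_pos,
      mem_sphere_zero_iff_norm.1 y.2, mul_one]
    exact B.ε_lt.le

/-- **The bottom level is simply connected in dimension `n + 1 ≥ 3`**, for any space embedded
onto it (it is an `n`-sphere, `n ≥ 2`; Hatcher Prop. 1.14, tree theorem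
`simplyConnectedSpace_sphere`). [cite: HatcherAT2002, Prop. 1.14] -/
theorem simplyConnectedSpace_of_range_eq (hn : 2 ≤ n) (V : Type*) [TopologicalSpace V] (ι : V → c.W)
    (hι : Topology.IsEmbedding ι) (hrange : range ι = B.f ⁻¹' {B.botLevel}) : SimplyConnectedSpace V := by
  haveI : Fact (Module.finrank ℝ (𝔼 (n + 1)) = n + 1) := ⟨finrank_euclideanSpace_fin⟩
  haveI := simplyConnectedSpace_sphere (E := 𝔼 (n + 1)) (n := n) hn
  have e₁ : V ≃ₜ ↥(range ι) := hι.toHomeomorph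
  have e₂ : ↥(range ι) ≃ₜ ↥(B.f ⁻¹' {B.botLevel}) := Homeomorph.setCongr hrange
  exact ((e₁.trans e₂).trans B.levelHomeomorphSphere).toHomotopyEquiv.simplyConnectedSpace_iff.2
    inferInstance

/-- **The sublevel set below the bottom level is homeomorphic to a closed ball** (chart
coordinates). [cite: Milnor1963, §3 (Thm. 3.1: `Mᵃ` is a disc below the first critical level)] -/
def sublevelHomeomorphClosedBall :
    ↥{q | B.f q ≤ B.botLevel} ≃ₜ Metric.closedBall (0 : 𝔼 (n + 1)) B.ε where
  toFun q := ⟨B.coord q.1, by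
    rw [mem_closedBall_zero_iff]; exact ((B.apply_le_botLevel_iff q.1).1 q.2).2⟩
  invFun v := ⟨(B.chart.extend (𝓡∂ (n + 1))).symm (B.chart.extend (𝓡∂ (n + 1)) B.p₀ + (v : 𝔼 (n + 1))), by
    have hv : ‖(v : 𝔼 (n + 1))‖ ≤ B.ε := mem_closedBall_zero_iff.1 v.2
    obtain ⟨hs, hc⟩ := B.symm_add_mem_source (v := (v : 𝔼 (n + 1))) (hv.trans B.ε_lt.le)
    exact (B.apply_le_botLevel_iff _).2 ⟨hs, by rw [hc]; exact hv⟩⟩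
  left_inv q := Subtype.ext (B.symm_add_coord ((B.apply_le_botLevel_iff q.1).1 q.2).1)
  right_inv v := by
    apply Subtype.ext
    have hv : ‖(v : 𝔼 (n + 1))‖ ≤ B.ε := mem_closedBall_zero_iff.1 v.2
    exact (B.symm_add_mem_source (v := (v : 𝔼 (n + 1))) (hv.trans B.ε_lt.le)).2
  continuous_toFun := by
    refine Continuous.subtype_mk ?_ _
    have hsub : ∀ q : ↥{q | B.f q ≤ B.botLevel}, q.1 ∈ B.chart.source := fun q =>
      ((B.apply_le_botLevel_iff q.1).1 q.2).1
    exact B.continuousOn_coord.comp_continuous continuous_subtype_val hsub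
  continuous_invFun := by
    refine Continuous.subtype_mk ?_ _
    have h1 : Continuous fun v : Metric.closedBall (0 : 𝔼 (n + 1)) B.ε =>
        B.chart.extend (𝓡∂ (n + 1)) B.p₀ + (v : 𝔼 (n + 1)) :=
      continuous_const.add continuous_subtype_val
    refine (B.chart.continuousOn_extend_symm (I := 𝓡∂ (n + 1))).comp_continuous h1 fun v => ?_
    refine B.closedBall_subset ?_
    show dist _ _ ≤ B.ρ
    rw [dist_eq_norm, add_sub_cancel_left]
    exact (mem_closedBall_zero_iff.1 v.2).trans B.ε_lt.le

/-- **The sublevel set below the bottom level is contractible** (a closed ball).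
[cite: Milnor1963, §3 (Thm. 3.1)] -/
theorem contractibleSpace_setOf_le : ContractibleSpace ↥{q | B.f q ≤ B.botLevel} :=
  B.sublevelHomeomorphClosedBall.contractibleSpace_iff.2
    ((convex_closedBall (0 : 𝔼 (n + 1)) B.ε).contractibleSpace ⟨0, mem_closedBall_self B.ε_pos.le⟩)

/-- The bottom critical point lies in the sublevel set below the bottom level. [folklore] -/
theorem p₀_mem_setOf_le : B.p₀ ∈ {q | B.f q ≤ B.botLevel} := B.apply_p₀_lt_botLevel.le

/-! ### The complement of the open bottom ball is simply connected -/

/-- **A Euclidean neighbourhood of the bottom critical point**: an open embedding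
`i : ℝⁿ⁺¹ → W` with `i 0 = p₀` (the open chart ball of radius `ρ`, reparametrised by
`OpenPartialHomeomorph.univBall`). [folklore] -/
theorem exists_isOpenEmbedding_apply_zero_eq :
    ∃ i : 𝔼 (n + 1) → c.W, Topology.IsOpenEmbedding i ∧ i 0 = B.p₀ := by
  set φ := B.chart.extend (𝓡∂ (n + 1)) with hφ
  -- the chart restricted to the open ball of radius `ρ`, as an open partial homeomorphism into `E`
  have hballt : ball (φ B.p₀) B.ρ ⊆ φ.target := ball_subset_closedBall.trans B.closedBall_subset
  have hsrc_open : IsOpen (B.chart.source ∩ φ ⁻¹' ball (φ B.p₀) B.ρ) := by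
    have h := B.chart.continuousOn_extend (I := 𝓡∂ (n + 1))
    rw [B.chart.extend_source] at h
    exact h.isOpen_inter_preimage B.chart.open_source isOpen_ball
  let e : OpenPartialHomeomorph c.W (𝔼 (n + 1)) :=
    { toFun := φ
      invFun := φ.symm
      source := B.chart.source ∩ φ ⁻¹' ball (φ B.p₀) B.ρ
      target := ball (φ B.p₀) B.ρ
      map_source' := fun q hq => hq.2
      map_target' := fun v hv => by
        refine ⟨?_, ?_⟩
        · rw [← B.chart.extend_source (I := 𝓡∂ (n + 1))]; exact φ.map_target (hballt hv)
        · show φ (φ.symm v) ∈ ball (φ B.p₀) B.ρ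
          rw [φ.right_inv (hballt hv)]; exact hv
      left_inv' := fun q hq => by
        have : q ∈ φ.source := by rw [B.chart.extend_source]; exact hq.1
        exact φ.left_inv this
      right_inv' := fun v hv => φ.right_inv (hballt hv)
      open_source := hsrc_open
      open_target := isOpen_ball
      continuousOn_toFun := by
        have h := B.chart.continuousOn_extend (I := 𝓡∂ (n + 1))
        rw [B.chart.extend_source] at h
        exact h.mono inter_subset_left
      continuousOn_invFun :=
        (B.chart.continuousOn_extend_symm (I := 𝓡∂ (n + 1))).mono hballt }
  set u := OpenPartialHomeomorph.univBall (φ B.p₀) B.ρ with hu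
  have hu_src : u.source = univ := OpenPartialHomeomorph.univBall_source _ _
  have hu_tgt : u.target = ball (φ B.p₀) B.ρ := OpenPartialHomeomorph.univBall_target _ B.ρ_pos
  set g := u.trans e.symm with hg
  have hg_src : g.source = univ := by
    rw [hg, OpenPartialHomeomorph.trans_source, hu_src, univ_inter, eq_univ_iff_forall]
    intro v
    show u v ∈ e.symm.source
    rw [OpenPartialHomeomorph.symm_source]
    show u v ∈ ball (φ B.p₀) B.ρ
    rw [← hu_tgt]; exact u.map_source (by rw [hu_src]; exact mem_univ v)
  refine ⟨g, g.to_isOpenEmbedding hg_src, ?_⟩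
  show φ.symm (u 0) = B.p₀
  rw [hu, OpenPartialHomeomorph.univBall_apply_zero]
  exact B.chart.extend_left_inv (I := 𝓡∂ (n + 1)) B.mem_source

/-- The radial projection of the punctured bottom ball onto the bottom level. [folklore] -/
def radial (q : c.W) : c.W :=
  (B.chart.extend (𝓡∂ (n + 1))).symm
    (B.chart.extend (𝓡∂ (n + 1)) B.p₀ + (B.ε / ‖B.coord q‖) • B.coord q)

/-- The radial projection of a point of the punctured bottom ball lands on the bottom level.
[folklore] -/
theorem radial_mem {q : c.W} (hq : B.f q ≤ B.botLevel) (hqp : q ≠ B.p₀) :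
    B.radial q ∈ B.chart.source ∧ ‖B.coord (B.radial q)‖ = B.ε := by
  have hq' := (B.apply_le_botLevel_iff q).1 hq
  have hc0 : B.coord q ≠ 0 := fun h0 => hqp (by
    have := B.symm_add_coord hq'.1
    rw [h0, add_zero, B.chart.extend_left_inv (I := 𝓡∂ (n + 1)) B.mem_source] at this
    exact this.symm)
  have hnorm : ‖(B.ε / ‖B.coord q‖) • B.coord q‖ = B.ε := by
    rw [norm_smul, Real.norm_eq_abs, abs_of_pos (div_pos B.ε_pos (norm_pos_iff.2 hc0)),
      div_mul_cancel₀ _ (norm_ne_zero_iff.2 hc0)]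
  obtain ⟨hs, hc⟩ := B.symm_add_mem_source (v := (B.ε / ‖B.coord q‖) • B.coord q)
    (by rw [hnorm]; exact B.ε_lt.le)
  exact ⟨hs, by rw [radial, hc, hnorm]⟩

/-- The radial projection fixes the bottom level. [folklore] -/
theorem radial_eq_self {q : c.W} (hq : B.f q = B.botLevel) : B.radial q = q := by
  have hq' := (B.apply_eq_botLevel_iff q).1 hq
  rw [radial, hq'.2, div_self B.ε_pos.ne', one_smul]
  exact B.symm_add_coord hq'.1

/-- The radial projection is continuous on the punctured bottom ball. [folklore] -/
theorem continuousOn_radial : ContinuousOn B.radial ({q | B.f q ≤ B.botLevel} ∩ {B.p₀}ᶜ) := by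
  have hsub : {q | B.f q ≤ B.botLevel} ∩ {B.p₀}ᶜ ⊆ B.chart.source := fun q hq =>
    B.setOf_le_subset hq.1
  have hc0 : ∀ q ∈ {q | B.f q ≤ B.botLevel} ∩ {B.p₀}ᶜ, B.coord q ≠ 0 := by
    rintro q ⟨hq, hqp⟩ h0
    apply hqp
    have := B.symm_add_coord (B.setOf_le_subset hq)
    rw [h0, add_zero, B.chart.extend_left_inv (I := 𝓡∂ (n + 1)) B.mem_source] at this
    exact this.symm
  have hcoord : ContinuousOn B.coord ({q | B.f q ≤ B.botLevel} ∩ {B.p₀}ᶜ) :=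
    B.continuousOn_coord.mono hsub
  have hscal : ContinuousOn (fun q => B.ε / ‖B.coord q‖) ({q | B.f q ≤ B.botLevel} ∩ {B.p₀}ᶜ) :=
    continuousOn_const.div hcoord.norm fun q hq => norm_ne_zero_iff.2 (hc0 q hq)
  have hin : ContinuousOn (fun q => B.chart.extend (𝓡∂ (n + 1)) B.p₀ + (B.ε / ‖B.coord q‖) • B.coord q)
      ({q | B.f q ≤ B.botLevel} ∩ {B.p₀}ᶜ) :=
    continuousOn_const.add (hscal.smul hcoord)
  refine (B.chart.continuousOn_extend_symm (I := 𝓡∂ (n + 1))).comp hin fun q hq => ?_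
  refine B.closedBall_subset ?_
  show dist _ _ ≤ B.ρ
  rw [dist_eq_norm, add_sub_cancel_left, norm_smul, Real.norm_eq_abs,
    abs_of_pos (div_pos B.ε_pos (norm_pos_iff.2 (hc0 q hq))),
    div_mul_cancel₀ _ (norm_ne_zero_iff.2 (hc0 q hq))]
  exact B.ε_lt.le

open Classical in
/-- The retraction of `W ∖ {p₀}` onto `{a₀ ≤ f}`: radial projection on the bottom ball, the
identity outside. [folklore] -/
def retraction (q : c.W) : c.W := if B.f q ≤ B.botLevel then B.radial q else q

/-- **`{a₀ ≤ f} = W ∖ B̊` is simply connected when `W` is** (dimension `n + 1 ≥ 3`): it is a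
retract of `W ∖ {p₀}` (Hatcher Prop. 1.17, tree lemma `IsSimplyConnected.of_retraction`), which
is simply connected by general position (`isSimplyConnected_compl_singleton_of_isOpenEmbedding`,
Hatcher Prop. 1.14 / Kosinski VI.2).  This is the simple connectivity of Wall's `W − D̊⁵`
(and of Kervaire–Milnor's `W` with an open disc removed, proof of Lemma 2.3).
[cite: HatcherAT2002, Prop. 1.14 and Prop. 1.17] [cite: WallJLMS1964, proof of Lemma 2 (p. 144)] -/
theorem isSimplyConnected_setOf_le [SimplyConnectedSpace c.W] (hn : 2 ≤ n) :
    IsSimplyConnected {q | B.botLevel ≤ B.f q} := by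
  classical
  -- `W ∖ {p₀}` is simply connected
  obtain ⟨i, hi, hi0⟩ := B.exists_isOpenEmbedding_apply_zero_eq
  have hA : IsSimplyConnected ({B.p₀}ᶜ : Set c.W) := by
    rw [← hi0]
    exact Literature.AlgebraicTopology.FundamentalGroupoid.isSimplyConnected_compl_singleton_of_isOpenEmbedding hi
      (by rw [finrank_euclideanSpace_fin]; omega)
  -- the retraction
  refine IsSimplyConnected.of_retraction hA (r := B.retraction) ?_ ?_ ?_ ?_
  · -- continuity on `W ∖ {p₀}`
    refine ContinuousOn.if ?_ ?_ ?_
    · rintro q ⟨-, hq⟩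
      have hqf : B.f q = B.botLevel := by
        have h1 : q ∈ frontier {a | B.f a ≤ B.botLevel} := hq
        have h2 : frontier {a | B.f a ≤ B.botLevel} ⊆ {a | B.f a = B.botLevel} :=
          frontier_le_subset_eq B.continuous continuous_const
        exact h2 h1
      exact B.radial_eq_self hqf
    · have hcl : closure {a | B.f a ≤ B.botLevel} = {a | B.f a ≤ B.botLevel} :=
        (isClosed_le B.continuous continuous_const).closure_eq
      rw [hcl, inter_comm]
      exact B.continuousOn_radial
    · exact continuousOn_id
  · -- maps into `{a₀ ≤ f}`
    intro q hq
    by_cases h : B.f q ≤ B.botLevel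
    · rw [retraction, if_pos h]
      obtain ⟨hs, hc⟩ := B.radial_mem h hq
      show B.botLevel ≤ B.f (B.radial q)
      rw [B.apply_eq_coord hs, hc, botLevel_def]
    · rw [retraction, if_neg h]
      exact (not_le.1 h).le
  · -- `{a₀ ≤ f} ⊆ W ∖ {p₀}`
    intro q hq hqp
    rw [mem_singleton_iff] at hqp
    rw [hqp] at hq
    exact not_le.2 B.apply_p₀_lt_botLevel hq
  · -- the identity on `{a₀ ≤ f}`
    intro q hq
    by_cases h : B.f q ≤ B.botLevel
    · rw [retraction, if_pos h]
      exact B.radial_eq_self (le_antisymm h hq)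
    · rw [retraction, if_neg h]

end BottomBall

/-! ### Existence -/

section Existence

variable [T2Space M] [SecondCountableTopology M] [IsManifold (𝓡 n) ∞ M] [CompactSpace M]

/-- **A Morse function with distinct critical values on the triad `(W; ∅, M)`** (Milnor 1965,
Thm. 2.5 with Lemma 2.8): from a Morse function adapted to `∂W` (the tree's
`exists_isMorseAdapted_realHalfSpace`, Thm. 2.5 for the triad `(W; ∅, ∂W)`) rescaled to
Def. 3.1, and Lemma 2.8 (`Cobordism.Milnor1965_exists_injOn_criticalSet_holds`).
[cite: MilnorHCobordism1965, Thm. 2.5, Lemma 2.8, Def. 3.1 (PDF pp. 6–11)] -/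
theorem exists_isMorseFunction_injOn :
    ∃ f : c.W → ℝ, c.cob.IsMorseFunction f ∧ InjOn f (criticalSet (𝓡∂ (n + 1)) f) := by
  obtain ⟨f₀, hf₀⟩ := exists_isMorseAdapted_realHalfSpace (n := n) (M := c.W)
  -- a lower bound for `f₀` on the compact `W`
  have hbdd : BddBelow (range f₀) := (isCompact_range hf₀.1.contMDiff.continuous).bddBelow
  obtain ⟨m, hm⟩ := hbdd
  have hm' : ∀ z, m ≤ f₀ z := fun z => hm (mem_range_self z)
  rcases isEmpty_or_nonempty c.W with hW | hW
  · refine ⟨f₀, ⟨hf₀.1, fun x => isEmptyElim x, fun y => hW.elim (c.incl y),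
      fun (z : c.W) => hW.elim z, fun (z : c.W) => hW.elim z⟩, fun z => hW.elim z⟩
  -- `m ≤ 1`: `f₀ ≤ 1` somewhere (everywhere, in fact)
  have hm1 : m ≤ 1 := by
    obtain ⟨z⟩ := hW
    rcases ((𝓡∂ (n + 1)).isInteriorPoint_or_isBoundaryPoint z) with hz | hz
    · exact (hm' z).trans (hf₀.2.2 z hz).le
    · exact (hm' z).trans (hf₀.2.1 z hz).1.le
  have hF := c.isMorseFunction_cob_of_isMorseAdapted hf₀ hm' hm1
  obtain ⟨f, hf, hcrit, -, hinj⟩ := Cobordism.Milnor1965_exists_injOn_criticalSet_holds hF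
  exact ⟨f, hf, by rwa [← hcrit] at hinj⟩

variable [Nonempty M]

/-- **Existence of the bottom ball** (the module docstring's item list): choose a Morse function
with distinct critical values on `(W; ∅, M)`, its global minimum `p₀` (interior, as the values
inside are `< 1 = f|M`; critical by Fermat; unique by Lemma 2.8), a Milnor chart at `p₀`
(`IsGradientLike.exists_milnorBox_source_subset`, with index `0` forced by minimality), and
`ε` below the distance, in values of `f`, from `f(p₀)` to `1`, to the other critical values and
to the minimum of `f` off the open chart ball (compactness).
[cite: MilnorHCobordism1965, Thm. 2.5, Lemma 2.8, Def. 3.1 (PDF pp. 6–12)] [cite: WallJLMS1964, proof of Lemma 2 (p. 144)] -/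
theorem nonempty_bottomBall : Nonempty c.BottomBall := by
  classical
  obtain ⟨f, hf, hinj⟩ := c.exists_isMorseFunction_injOn
  have hfs : ContMDiff (𝓡∂ (n + 1)) 𝓘(ℝ, ℝ) ∞ f := hf.isMorse.contMDiff
  have hfc : Continuous f := hfs.continuous
  -- an interior point, where `f < 1`
  obtain ⟨w, hw⟩ := c.exists_isInteriorPoint
  have hwval : f w ∈ Ioo (0 : ℝ) 1 := hf.2.2.2.2 w hw
  -- values on the boundary are `1`
  have hbd : ∀ z : c.W, (𝓡∂ (n + 1)).IsBoundaryPoint z → f z = 1 := by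
    intro z hz
    have hz' : z ∈ (𝓡∂ (n + 1)).boundary c.W := hz
    rw [← c.range_incl] at hz'
    obtain ⟨y, rfl⟩ := hz'
    exact hf.2.2.1 y
  -- the global minimum
  haveI : Nonempty c.W := ⟨w⟩
  obtain ⟨p₀, -, hmin⟩ :=
    isCompact_univ.exists_isMinOn univ_nonempty hfc.continuousOn
  have hle : ∀ q, f p₀ ≤ f q := fun q => by
    have h : f p₀ ≤ f q := hmin (mem_univ q)
    exact h
  have hp₀1 : f p₀ < 1 := (hle w).trans_lt hwval.2
  have hint : ∀ q : c.W, f q < 1 → (𝓡∂ (n + 1)).IsInteriorPoint q := fun q hq =>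
    ((𝓡∂ (n + 1)).isInteriorPoint_iff_not_isBoundaryPoint q).2 fun hb => hq.ne (hbd q hb)
  have hp₀int : (𝓡∂ (n + 1)).IsInteriorPoint p₀ := hint p₀ hp₀1
  have hcrit_of : ∀ q, (∀ q', f q ≤ f q') → IsMCriticalPt (𝓡∂ (n + 1)) f q := fun q hq =>
    isMCriticalPt_of_isLocalMin
      (IsMinOn.isLocalMin (fun q' _ => hq q') univ_mem) (hint q ((hq w).trans_lt hwval.2))
  have hp₀crit : IsMCriticalPt (𝓡∂ (n + 1)) f p₀ := hcrit_of p₀ hle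
  -- uniqueness of the minimum (Lemma 2.8)
  have hlt : ∀ q, q ≠ p₀ → f p₀ < f q := by
    intro q hq
    refine lt_of_le_of_ne (hle q) fun heq => hq ?_
    have hqmin : ∀ q', f q ≤ f q' := fun q' => heq ▸ hle q'
    exact hinj (hcrit_of q hqmin) hp₀crit heq.symm
  -- a Milnor chart at `p₀`; the index of its normal form is `0` by minimality
  obtain ⟨ξ, hξ⟩ := Cobordism.Milnor1965_exists_isGradientLike_holds (c := c.cob) hf
  obtain ⟨D, -⟩ := hξ.exists_milnorBox_source_subset (X := ⇑ξ) hp₀crit hp₀int isOpen_univ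
    (mem_univ _) (fun _ _ => rfl)
  have hε := D.eps_pos
  have hk0 : D.k = 0 := by
    by_contra hk
    have hk' : 0 < D.k := Nat.pos_of_ne_zero hk
    set i₀ : Fin (n + 1) := ⟨0, Nat.succ_pos n⟩ with hi₀
    have hi₀k : (i₀ : ℕ) < D.k := hk'
    set v : 𝔼 (n + 1) := EuclideanSpace.single i₀ D.ε with hv
    have hA : sqSumLT D.k v = D.ε ^ 2 := sqSumLT_single_of_lt hi₀k _
    have hB : sqSumGE D.k v = 0 := sqSumGE_single_of_lt hi₀k _
    obtain ⟨hz, hcz⟩ := D.symm_add_mem_source_and_coord_eq (v := v) (by rw [hA])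
      (by rw [hB]; positivity)
    have hval := D.apply_eq _ hz
    rw [milnorQuadratic_eq] at hval
    have hval' : f ((D.chart.extend (𝓡∂ (n + 1))).symm (D.chart.extend (𝓡∂ (n + 1)) p₀ + v)) =
        f p₀ + (-sqSumLT D.k (D.coord _) + sqSumGE D.k (D.coord _)) := hval
    rw [hcz, hA, hB] at hval'
    have := hle ((D.chart.extend (𝓡∂ (n + 1))).symm (D.chart.extend (𝓡∂ (n + 1)) p₀ + v))
    rw [hval'] at this
    nlinarith
  have happly : ∀ q ∈ D.chart.source, f q = f p₀ +
      ‖D.chart.extend (𝓡∂ (n + 1)) q - D.chart.extend (𝓡∂ (n + 1)) p₀‖ ^ 2 := by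
    intro q hq
    rw [D.apply_eq q hq, hk0, milnorQuadratic_zero_left]
  -- the open chart ball `U` of radius `D.ε` and the compact complement
  set U : Set c.W := D.chart.source ∩ D.coord ⁻¹' ball 0 D.ε with hU
  have hUo : IsOpen U := D.continuousOn_coord.isOpen_inter_preimage D.chart.open_source isOpen_ball
  have hp₀U : p₀ ∈ U := ⟨D.mem_source, by simp [hε]⟩
  have hKc : IsCompact Uᶜ := hUo.isClosed_compl.isCompact
  -- the three positive margins
  obtain ⟨δK, hδK, hδKf⟩ : ∃ δ : ℝ, 0 < δ ∧ ∀ q ∈ Uᶜ, f p₀ + δ ≤ f q := by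
    rcases (Uᶜ).eq_empty_or_nonempty with hK | hK
    · exact ⟨1, one_pos, fun q hq => by rw [hK] at hq; exact hq.elim⟩
    · obtain ⟨qK, hqK, hqKmin⟩ := hKc.exists_isMinOn hK hfc.continuousOn
      have hne : qK ≠ p₀ := fun h => hqK (h ▸ hp₀U)
      refine ⟨f qK - f p₀, sub_pos.2 (hlt qK hne), fun q hq => ?_⟩
      have h' : f qK ≤ f q := hqKmin hq
      linarith
  have hfin : (criticalSet (𝓡∂ (n + 1)) f \ {p₀}).Finite := hf.finite_criticalSet.subset fun x hx => hx.1
  obtain ⟨δC, hδC, hδCf⟩ : ∃ δ : ℝ, 0 < δ ∧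
      ∀ q ∈ criticalSet (𝓡∂ (n + 1)) f, q ≠ p₀ → f p₀ + δ ≤ f q := by
    rcases (criticalSet (𝓡∂ (n + 1)) f \ {p₀}).eq_empty_or_nonempty with hS | hS
    · refine ⟨1, one_pos, fun q hq hne => ?_⟩
      have : q ∈ criticalSet (𝓡∂ (n + 1)) f \ {p₀} := ⟨hq, hne⟩
      rw [hS] at this
      exact this.elim
    · obtain ⟨qC, hqC, hqCmin⟩ := Set.exists_min_image _ f hfin hS
      refine ⟨f qC - f p₀, sub_pos.2 (hlt qC hqC.2), fun q hq hne => ?_⟩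
      have := hqCmin q ⟨hq, hne⟩
      linarith
  have hδ1 : 0 < 1 - f p₀ := sub_pos.2 hp₀1
  set η : ℝ := min (min δK δC) (1 - f p₀) with hη
  have hηpos : 0 < η := lt_min (lt_min hδK hδC) hδ1
  have hηK : η ≤ δK := (min_le_left _ _).trans (min_le_left _ _)
  have hηC : η ≤ δC := (min_le_left _ _).trans (min_le_right _ _)
  have hη1 : η ≤ 1 - f p₀ := min_le_right _ _
  set ε : ℝ := min (D.ε / 2) (Real.sqrt η / 2) with hεdef
  have hεpos : 0 < ε := lt_min (by linarith) (by positivity)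
  have hεD : ε < D.ε := (min_le_left _ _).trans_lt (by linarith)
  have hε2 : ε ^ 2 < η := by
    have h1 : ε ≤ Real.sqrt η / 2 := min_le_right _ _
    have h2 : Real.sqrt η ^ 2 = η := Real.sq_sqrt hηpos.le
    have h3 : 0 < Real.sqrt η := Real.sqrt_pos.2 hηpos
    nlinarith
  refine ⟨{
    f := f
    isMorseFunction := hf
    injOn := hinj
    p₀ := p₀
    apply_le := hle
    isInteriorPoint := hp₀int
    isMCriticalPt := hp₀crit
    chart := D.chart
    mem_maximalAtlas := D.mem_maximalAtlas
    mem_source := D.mem_source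
    ρ := 3 * D.ε
    ρ_pos := by linarith
    closedBall_subset := D.closedBall_subset
    apply_eq := happly
    ε := ε
    ε_pos := hεpos
    ε_lt := by linarith
    level_lt_one := by linarith
    level_lt_apply := fun q hq hne => by linarith [hδCf q hq hne]
    setOf_le_subset := fun q hq => ?_ }⟩
  -- a point with `f q ≤ a₀` lies in the open chart ball `U`, hence in the chart domain
  by_contra hqs
  have hqU : q ∈ Uᶜ := fun hqU => hqs hqU.1
  have h1 := hδKf q hqU
  have h2 : f q ≤ f p₀ + ε ^ 2 := hq
  linarith

end Existence

end NullCobordism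

end Setting

end Literature.Topology.FourManifolds
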